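import Mathlib
import Literature.Barriers.MatrixMultiplication.NormalizerBarrier
import Literature.RepresentationTheory.FiniteGroups.CharacterDegrees
import Literature.RepresentationTheory.FiniteGroups.IrreducibleCharacters
import Literature.RepresentationTheory.FiniteGroups.BrauerInduction
import Literature.RepresentationTheory.FiniteGroups.MonomialRepresentation
import Summits.MatrixMultiplication.MatrixMultiplication.Theorems.LieRankDesigns.Negative.Basics
import Summits.MatrixMultiplication.MatrixMultiplication.Theorems.LevelGradedCohnUmansLieRankDesignsStubLevelOfFixedVector
import Summits.MatrixMultiplication.MatrixMultiplication.Theorems.SubgroupIdentityDesigns.Negative.BorelLevelOne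
import Summits.MatrixMultiplication.MatrixMultiplication.Theorems.SubgroupIdentityDesigns.Negative.BlockSliceDesignOne
import Summits.MatrixMultiplication.MatrixMultiplication.Theorems.SubgroupIdentityDesigns.Negative.BlockSliceConditional
import Summits.MatrixMultiplication.MatrixMultiplication.Theorems.SubgroupIdentityDesigns.Negative.LineStabilizer
import Summits.MatrixMultiplication.MatrixMultiplication.Theorems.SubgroupIdentityDesigns.Negative.LineStabilizerCharacter

/-!
# Block slices, VI: the budget Lemma 2.1 at `k = 1`, UNCONDITIONALLY — no slice `S_{1+l,1}`
# (`l ≥ 3`) carries a witness of the crux `SubgroupIdentityDesigns`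

Supports stmt-MatrixMultiplication-14079 (route `LevelGradedCohnUmans`).  VALUE = theorem, NOT summit
progress.  `BlockSliceConditional.not_budget_lt_of_slice_eps` refuted the crux's graded-budget
inequality on every (conjugate) block-slice triple GIVEN one irreducible character `χ` of
`GL_{k+l}(𝔽_p)` of level `≤ k` and degree `≥ D = p^{kl+k(k-1)/2}` (BLOCK-SLICES Lemma 2.1, there a
hypothesis).  Here that hypothesis is DISCHARGED for `k = 1`:

* `theta_mem_levelSet` — the permutation character `θ = Ind_P^G 1` of `G = GL_{1+l}(𝔽_p)` on lines
  has level `≤ 1`: `θ(y) = #{lines fixed by y} = ∑_{lines L} ∑_{a ∈ 𝔽_p} [y v_L = a v_L]`, a sum of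
  rank-`1` fibre indicators (`BlockSliceDesignOne.fib_mem`);
* `card_quotient_ge` — `[G : P] ≥ p^l + 1` (the lines through `(1, u)`, `u ∈ 𝔽_p^l`, and one more);
* `exists_irrChar_levelOne` — **Lemma 2.1 (`k = 1`)**: `χ = θ − 1 ∈ Irr(G) ∩ F_1` (irreducible by
  `LineStabilizerCharacter.isIrrChar_theta_sub_triv`, level `≤ 1` by `sub_mem_levelSet`) with
  `χ(1) = [G : P] − 1 ≥ p^l = D`;
* `no_slice_witness_one` — **THEOREM 2.4 at `k = 1`, unconditional**: for `l ≥ 3`, every `ε > 0`,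
  every `x` and every `SubgroupTPP` triple `H₁, H₂, H₃ ≤ GL_{1+l}(𝔽_p)` with
  `x⁻¹ H₁H₂H₃ x ⊆ S_{1+l,1}` (lower-right `l × l` block `= 1`), the crux inequality
  `∑ᶠ_{ψ ∈ Irr ∩ F_1} (ψ 1).re^{2+ε} < (|H₁||H₂||H₃|)^{(2+ε)/3}` is FALSE.  Together with
  `BlockSliceDesignOne` (the design clause HOLDS on these triples) this settles the slices `S_{m,1}`,
  `m ≥ 4`, completely: designs for free, never enough volume.
-/

set_option linter.dupNamespace false

noncomputable section

open scoped BigOperators Matrix Classical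
open Literature.Barriers.MatrixMultiplication (SubgroupTPP)
open Literature.RepresentationTheory.FiniteGroups
open Summit.MatrixMultiplication.MatrixMultiplication.Theorems.LieRankDesigns.Negative
  (GLm Mat levelSet trivial_mem_levelSet character_trivial_apply)
open Summit.MatrixMultiplication.MatrixMultiplication.Theorems.LieRankDesigns.LevelOfFixedVector
  (sum_mem_levelSet)

namespace Summit.MatrixMultiplication.MatrixMultiplication.Theorems.SubgroupIdentityDesigns.Negative
namespace BlockSliceBudgetOne

open LineStabilizer LineStabilizerCharacter
open BlockSliceDesignOne (i0 vec fib fib_mem vec_castAdd vec_natAdd)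
open BlockSliceConditional (not_budget_lt_of_slice_eps)

/-! ## Two more facts about `G ⧸ P` over a general finite field -/

section General

variable {F : Type} [Field F] [Fintype F] {n : ℕ} (i₀ : Fin n)

omit [Fintype F] in
/-- `gP = g'P ↔ g' e_{i₀} ∈ F · g e_{i₀}` (cosets of `P` = lines). -/
theorem coe_eq_coe_iff (g g' : GL (Fin n) F) :
    (g : GL (Fin n) F ⧸ lineStab (F := F) i₀) = (g' : GL (Fin n) F ⧸ lineStab (F := F) i₀) ↔
      ∃ a : F, (g' : Matrix (Fin n) (Fin n) F) *ᵥ Pi.single i₀ 1 =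
        a • ((g : Matrix (Fin n) (Fin n) F) *ᵥ Pi.single i₀ 1) := by
  rw [QuotientGroup.eq, mem_lineStab_iff]
  refine exists_congr fun a => ?_
  rw [Units.val_mul, ← Matrix.mulVec_mulVec]
  constructor
  · intro h
    have := (mulVec_eq_iff g⁻¹ _ _).mp h
    rw [inv_inv, Matrix.mulVec_smul] at this
    exact this
  · intro h
    rw [h, Matrix.mulVec_smul, inv_mulVec_mulVec]

/-- `GL_n(F)` (`n ≥ 2`) is transitive on non-zero vectors. -/
theorem exists_GL_mulVec_eq (hn : 1 < n) {x y : Fin n → F} (hx : x ≠ 0) (hy : y ≠ 0) :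
    ∃ g : GL (Fin n) F, (g : Matrix (Fin n) (Fin n) F) *ᵥ x = y := by
  have hV : 1 < Module.finrank F (Fin n → F) := by rwa [Module.finrank_fin_fun]
  obtain ⟨x', hx'⟩ := exists_linearIndependent_pair_of_one_lt_finrank hV hx
  obtain ⟨y', hy'⟩ := exists_linearIndependent_pair_of_one_lt_finrank hV hy
  obtain ⟨g, hg, -⟩ := exists_GL_pair hx' hy'
  exact ⟨g, hg⟩

omit [Fintype F] in
/-- An invertible matrix kills no non-zero vector. -/
theorem mulVec_ne_zero (g : GL (Fin n) F) {x : Fin n → F} (hx : x ≠ 0) :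
    (g : Matrix (Fin n) (Fin n) F) *ᵥ x ≠ 0 := fun h => by
  rw [mulVec_eq_iff, Matrix.mulVec_zero] at h
  exact hx h

end General

/-! ## `G = GL_{1+l}(𝔽_p)`, `P` = stabiliser of the line `𝔽_p e₀` -/

variable {p : ℕ} [hp : Fact p.Prime] {l : ℕ}

local notation "G₁" => GLm p (1 + l)
local notation "Q₁" => GLm p (1 + l) ⧸ lineStab (F := ZMod p) (i0 : Fin (1 + l))
/-- `θ = Ind_P^G 1` on `GL_{1+l}(𝔽_p)`. -/
local notation "θ₁" =>
  indClassFun (G := GLm p (1 + l)) (lineStab (F := ZMod p) (i0 : Fin (1 + l))) (fun _ => (1 : ℂ))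
/-- The trivial character of `GL_{1+l}(𝔽_p)`. -/
local notation "𝟙" => Representation.character (Representation.trivial ℂ (GLm p (1 + l)) ℂ)

/-- "`y` fixes the line through `v`" is the sum over `a ∈ 𝔽_p` of the fibre indicators
`[y v = a v]` (at most one `a` occurs). -/
theorem ite_exists_eq_sum {v : Fin (1 + l) → ZMod p} (hv : v ≠ 0) (y : G₁) :
    (if ∃ a : ZMod p, (y : Mat p (1 + l)) *ᵥ v = a • v then (1 : ℂ) else 0) =
      ∑ a : ZMod p, fib v (a • v) y := by
  unfold fib
  by_cases h : ∃ a : ZMod p, (y : Mat p (1 + l)) *ᵥ v = a • v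
  · obtain ⟨a, ha⟩ := h
    rw [if_pos ⟨a, ha⟩, Finset.sum_eq_single a]
    · rw [if_pos ha]
    · intro b _ hb
      rw [if_neg]
      intro hb'
      have h0 : (b - a) • v = 0 := by rw [sub_smul, ← hb', ← ha, sub_self]
      exact hb (sub_eq_zero.mp ((smul_eq_zero.mp h0).resolve_right hv))
    · exact fun h' => absurd (Finset.mem_univ a) h'
  · rw [if_neg h]
    symm
    exact Finset.sum_eq_zero fun a _ => if_neg fun ha => h ⟨a, ha⟩

/-- **`θ = Ind_P^G 1` has level `≤ 1`.** -/
theorem theta_mem_levelSet : (fun y : G₁ => θ₁ y) ∈ levelSet p (1 + l) 1 := by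
  have he : (Pi.single (i0 : Fin (1 + l)) (1 : ZMod p) : Fin (1 + l) → ZMod p) ≠ 0 := by simp
  have hθ : (fun y : G₁ => θ₁ y) = fun y => ∑ q : Q₁, ∑ a : ZMod p,
      fib (((q.out : G₁) : Mat p (1 + l)) *ᵥ Pi.single i0 1)
        (a • (((q.out : G₁) : Mat p (1 + l)) *ᵥ Pi.single i0 1)) y := by
    funext y
    rw [theta_apply, Finset.natCast_card_filter]
    refine Finset.sum_congr rfl fun q _ => ?_
    have hiff : y • q = q ↔ ∃ a : ZMod p, (y : Mat p (1 + l)) *ᵥ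
        (((q.out : G₁) : Mat p (1 + l)) *ᵥ Pi.single i0 1) =
          a • (((q.out : G₁) : Mat p (1 + l)) *ᵥ Pi.single i0 1) :=
      (smul_eq_self_iff_mem _ y q).trans (conj_mem_lineStab_iff i0 y q.out)
    simp only [hiff]
    exact ite_exists_eq_sum (mulVec_ne_zero q.out he) y
  rw [hθ]
  exact sum_mem_levelSet _ _ fun q _ => sum_mem_levelSet _ _ fun a _ => fib_mem _ _

/-- `(1, u) ≠ 0`. -/
theorem vec_one_ne_zero (u : Fin l → ZMod p) : vec (1 : ZMod p) u ≠ 0 := fun e => by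
  have := congr_fun e (Fin.castAdd l (0 : Fin 1))
  rw [vec_castAdd] at this
  exact one_ne_zero this

/-- `(0, 1, …, 1) ≠ 0` for `l ≥ 1`. -/
theorem vec_zero_ne_zero (hl : 1 ≤ l) : vec (0 : ZMod p) (fun _ : Fin l => (1 : ZMod p)) ≠ 0 :=
  fun e => by
  have := congr_fun e (Fin.natAdd 1 ⟨0, hl⟩)
  rw [vec_natAdd] at this
  exact one_ne_zero this

/-- **`[G : P] ≥ p^l + 1`**: the lines through `(1, u)` (`u ∈ 𝔽_p^l`) and through `(0, 1, …, 1)`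
are pairwise distinct. -/
theorem card_quotient_ge (hl : 1 ≤ l) : p ^ l + 1 ≤ Fintype.card Q₁ := by
  have hn : 1 < 1 + l := by omega
  have he : (Pi.single (i0 : Fin (1 + l)) (1 : ZMod p) : Fin (1 + l) → ZMod p) ≠ 0 := by simp
  have hex : ∀ x : Fin (1 + l) → ZMod p, x ≠ 0 →
      ∃ g : G₁, (g : Mat p (1 + l)) *ᵥ Pi.single i0 1 = x :=
    fun x hx => exists_GL_mulVec_eq hn he hx
  choose! gx hgx using hex
  let emb : Option (Fin l → ZMod p) → Q₁ := fun o =>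
    o.elim (gx (vec 0 fun _ => 1) : Q₁) fun u => (gx (vec 1 u) : Q₁)
  have hinj : Function.Injective emb := by
    rintro (_ | u) (_ | u') h
    · rfl
    · exfalso
      obtain ⟨a, ha⟩ := (coe_eq_coe_iff i0 _ _).mp h
      rw [hgx _ (vec_one_ne_zero u'), hgx _ (vec_zero_ne_zero hl)] at ha
      have := congr_fun ha (Fin.castAdd l (0 : Fin 1))
      simp at this
    · exfalso
      obtain ⟨a, ha⟩ := (coe_eq_coe_iff i0 _ _).mp h
      rw [hgx _ (vec_zero_ne_zero hl), hgx _ (vec_one_ne_zero u)] at ha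
      have h0 := congr_fun ha (Fin.castAdd l (0 : Fin 1))
      simp at h0
      have h1 := congr_fun ha (Fin.natAdd 1 ⟨0, hl⟩)
      rw [Pi.smul_apply, vec_natAdd, vec_natAdd, ← h0, zero_smul] at h1
      exact one_ne_zero h1
    · obtain ⟨a, ha⟩ := (coe_eq_coe_iff i0 _ _).mp h
      rw [hgx _ (vec_one_ne_zero u), hgx _ (vec_one_ne_zero u')] at ha
      have h0 := congr_fun ha (Fin.castAdd l (0 : Fin 1))
      simp at h0
      congr 1
      funext i
      have h1 := congr_fun ha (Fin.natAdd 1 i)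
      simp [← h0] at h1
      exact h1.symm
  calc p ^ l + 1 = Fintype.card (Option (Fin l → ZMod p)) := by
        rw [Fintype.card_option, Fintype.card_fun, ZMod.card, Fintype.card_fin]
    _ ≤ Fintype.card Q₁ := Fintype.card_le_of_injective emb hinj

/-- **BLOCK-SLICES Lemma 2.1 at `k = 1`, unconditionally**: an irreducible character of
`GL_{1+l}(𝔽_p)` of level `≤ 1` and degree `≥ p^l` (namely `Ind_P^G 1 − 1`). -/
theorem exists_irrChar_levelOne (hl : 1 ≤ l) :
    ∃ χ ∈ irrChars (GLm p (1 + l)) ∩ levelSet p (1 + l) 1, ((p ^ l : ℕ) : ℝ) ≤ (χ 1).re := by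
  have hn : 1 < 1 + l := by omega
  refine ⟨θ₁ - 𝟙, ⟨isIrrChar_theta_sub_triv (i0 : Fin (1 + l)) hn, ?_⟩, ?_⟩
  · have h := sub_mem_levelSet (theta_mem_levelSet (p := p) (l := l))
      (trivial_mem_levelSet (p := p) (m := 1 + l) 1).2
    exact h
  · rw [theta_sub_triv_one]
    have hcard : ((p ^ l : ℕ) : ℝ) + 1 ≤ (Fintype.card Q₁ : ℝ) := by
      exact_mod_cast card_quotient_ge (p := p) hl
    simp only [Complex.sub_re, Complex.natCast_re, Complex.one_re]
    linarith

/-- **THEOREM 2.4 at `k = 1`, UNCONDITIONAL**: for `l ≥ 3` no `SubgroupTPP` triple with products in a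
conjugate of the slice `S_{1+l,1}` satisfies the crux's graded-budget inequality, for any `ε > 0`. -/
theorem no_slice_witness_one (hl : 3 ≤ l) {H₁ H₂ H₃ : Subgroup (GLm p (1 + l))}
    (htpp : SubgroupTPP H₁ H₂ H₃) (x : GLm p (1 + l))
    (hS : ∀ a ∈ H₁, ∀ b ∈ H₂, ∀ c ∈ H₃, ∀ i j : Fin l,
      ((x⁻¹ * (a * b * c) * x : GLm p (1 + l)) : Mat p (1 + l)) (Fin.natAdd 1 i) (Fin.natAdd 1 j) =
        (1 : Matrix (Fin l) (Fin l) (ZMod p)) i j)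
    {ε : ℝ} (hε : 0 < ε) :
    ¬ ((∑ᶠ ψ ∈ irrChars (GLm p (1 + l)) ∩ levelSet p (1 + l) 1, (ψ 1).re ^ (2 + ε)) <
        ((Nat.card H₁ * Nat.card H₂ * Nat.card H₃ : ℕ) : ℝ) ^ ((2 + ε) / 3)) := by
  obtain ⟨χ, hχ, hdeg⟩ := exists_irrChar_levelOne (p := p) (l := l) (by omega)
  have hD : 1 * l + 1 * (1 - 1) / 2 = l := by norm_num
  exact not_budget_lt_of_slice_eps (k := 1) le_rfl hl hχ (by rw [hD]; exact hdeg) htpp x hS hε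

end BlockSliceBudgetOne
end Summit.MatrixMultiplication.MatrixMultiplication.Theorems.SubgroupIdentityDesigns.Negative
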